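import Literature.Analysis.FluidPDE.HyperbolicDSSOrbit
import Literature.Analysis.OperatorTheory.AlgebraicMultiplicity
import HarnessLib

/-!
# The period map (monodromy) of the rescaled Euler–Leray system linearised at a periodic profile,
  and the algebraic multiplicity of its Floquet multiplier `1`

Definition request `defn-rescaledEulerLerayMonodromy` of route `EulerMelnikovDss` (summit
NavierStokesRegularity; crux `FiniteMelnikovCokernel`, stmt-NavierStokesRegularity-1467), part (3)
"THE REAL REQUEST", designed together with — and on top of — the accepted companion notion
`IsLinearisedMonodromy w c R u M` of route `DssFarFieldSlaving` (`HyperbolicDSSOrbit`): same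
Hilbert spaces `X_w = divFreeL2 w` (weakly divergence-free fields in `L²(ℝ³, w dy; ℝ³)`,
any weight `w`; the short names below take the flat weight `w = 1`, see the design note "choice
of the space"), same semi-weak vorticity formulation (`IsLinearisedVorticitySolution`), same
convention "monodromy = bounded operator on `L²(w dy)` living on `X_w`, given as DATA
constrained by the dynamics it must reproduce".

## The operator family

For a profile `U(s, y)` on `ℝ × ℝ³` (time first) the rescaled vorticity equation of Leray's system
(`ν = 1`, backward similarity variables; companion file) linearised at `(U, Ω = curl U)` is
`∂ₛω = (Δ − ½ y·∇ − 1) ω + curl (U × ω) + curl (BS[ω] × Ω)`; its weak solutions on `[a, b]` are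
the accepted class `IsLinearisedVorticitySolution U Ω a b ω`. The rescaled Euler–Leray system with
parameter `ε` (route `EulerMelnikovDss`: `∂_σW + W·∇W + ∇Π = ε(ΔW − ½(W + y·∇W))`) is Leray's
system read through the amplitude–time rescaling `W(σ) = ε U(εσ)`, i.e. `U(τ) = ε⁻¹ W(τ/ε)`
(`amplitudeRescale ε W` of `RescaledEulerLeray.lean`), and its linearisation
`L_ε v = ∂_σ v + P[W₀·∇v + v·∇W₀] − ε(Δv − ½(v + y·∇v))` over a period `[0, P]` is, in vorticity
form and after `τ = εσ`, EXACTLY the `ε = 1` linearised equation at `U₀ = amplitudeRescale ε W₀`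
over `[0, εP]` (the solution spaces correspond by `ω̃(τ) = ω(τ/ε)`, the period maps coincide). We
therefore define ONE profile-level interface and specialise it twice:

* `IsLinearisedMonodromyAt w U P Q M` — `M : L²(w dy) →L L²(w dy)` maps `X_w` into itself,
  vanishes on `X_wᗮ`, and **propagates** every weak solution `ω` of the equation linearised at
  `(U, curl U)` on `[0, P]` whose initial slice defines an element of `X_w`:
  `M [ω(0)] = [π̃(Q⁻¹) ω(P)]`, `π̃` the accepted pseudovector action `pseudovectorPush` — the
  monodromy over the period `P` composed with the action of the isometry `Q`, for profiles that are
  `P`-periodic modulo `Q` in the route's convention `U (s + P) (Q y) = Q (U s y)` (then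
  `∂ₛΩ`, `Ω = curl U`, is reproduced with multiplier `1`). For `U = lerayOrbit u`, `P = 2 log c`,
  `Q = R⁻¹` this is VERBATIM the companion's `IsLinearisedMonodromy w c R u M`
  (`isLinearisedMonodromyAt_lerayOrbit_iff`).
* `IsRescaledEulerLerayMonodromyW w ε W₀ P Q M := IsLinearisedMonodromyAt w (amplitudeRescale ε W₀)
  (ε P) Q M` (the rescaling inlined, so that this file does not depend on `RescaledEulerLeray`):
  the period-`P` monodromy of `L_ε` at `W₀`, composed with `Q`; meaningful for `0 < ε`
  (`isRescaledEulerLerayMonodromyW_one_iff`: `ε = 1` is the profile-level notion itself).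
* `rescaledEulerLerayMonodromyW w ε W₀ P Q : L²(w dy) →L L²(w dy)` — THE monodromy when it exists
  and is unique, by (unique) choice; junk `0` otherwise — and
  `floquetMultiplicityW w ε W₀ P Q μ : ℕ∞` — the algebraic multiplicity
  (`Literature.Analysis.OperatorTheory.algebraicMultiplicity`, Kato III-§6.5: `⊤` unless `μ` is a
  regular point or an isolated eigenvalue of finite type) of the real Floquet multiplier `μ` of
  that monodromy, and `⊤` when no unique monodromy exists (no Floquet theory, no finite count).
* The requested short names `IsRescaledEulerLerayMonodromy`, `rescaledEulerLerayMonodromy ε W₀ P Q`,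
  `floquetMultiplicity ε W₀ P Q μ` and `floquetMultiplicityOne ε W₀ P Q := floquetMultiplicity ε
  W₀ P Q 1`, in the solenoidal VORTICITY space `L²_σ(ℝ³, dy)` (`w = 1`; see the design note
  "choice of the space" for why not the Gaussian weight of the request, which stays available as
  `floquetMultiplicityW gaussianWeight …`), with which crux #3 reads
  `∃ ε₁ > 0, ∃ m : ℕ, ∀ ε ∈ Set.Ioo 0 ε₁, floquetMultiplicityOne ε W₀ P Q = m`.

Proved API: the bridge to the companion notion; **uniqueness of the monodromy from density**
(`IsLinearisedMonodromyAt.unique_of_dense`: two monodromies agree as soon as the initial classes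
of weak solutions span a dense subspace of `X_w` — the honest form of "the period map is
determined by the dynamics"; with it the `∃!` guard is dischargeable by a solvability theory);
the unfolding lemmas of the choice functions (`…_eq`, `floquetMultiplicityW_eq`,
`floquetMultiplicityW_eq_top`, `floquetMultiplicityW_ne_top_iff`).

## Design notes (what is and is not asserted)

* Vorticity formulation (the request: "vorticity formulation acceptable, the Leray projector being
  unbounded on the weighted space"): the pressure disappears and `X_w` needs no Leray projector.
  As in the companion file, `M` is constrained only on the accepted solution class (continuous,
  slices in `L²(dy)`, absolutely convergent Biot–Savart integrals), which contains the classical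
  solutions from `C_c^∞` solenoidal data, and is otherwise free DATA; whether a bounded such `M`
  exists and is unique for `0 < ε ≪ 1` is analytic content of the crux and is not asserted.
  `floquetMultiplicityW = ⊤` records its failure, so a finite value is never obtained vacuously,
  and `IsLinearisedMonodromyAt.unique_of_dense` is the lever by which a solvability theory
  discharges the `∃!`.
* **Choice of the space for the short names (a recorded deviation from the letter of the
  request).** The request names the Gaussian space `L²_σ(e^{−|y|²/4} dy)`, "the weight making
  `Δ − ½y·∇` self-adjoint with compact resolvent". That weight DECAYS, so `X_γ` contains vorticities
  growing like `e^{|y|²/9}`, while the linearised Euler terms are nonlocal (Biot–Savart; in velocity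
  form, the pressure): a unit vector of `X_γ` carried by a compactly supported vortex blob of
  amplitude `~e^{L²/8}` at distance `L` induces a velocity `~e^{L²/8}L⁻³` at the origin, hence —
  through `curl (BS[ω] × Ω)` — a vorticity perturbation of that size near the origin after one
  period, where `γ ≈ 1`. So for a background with nonzero vorticity no BOUNDED operator on `X_γ`
  can propagate all classical solutions from `C_c^∞` data, and `floquetMultiplicityW gaussianWeight
  … = ⊤` must be expected identically — for a reason unrelated to the count crux #3 is after (and
  equally for the companion's `HasCompactLinearisedMonodromy gaussianWeight`). In VORTICITY form the
  purpose of the weight is already served by the flat space: on `L²(ℝ³, dy)`,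
  `⟨ε(Δ − ½y·∇ − 1)ω, ω⟩ = −ε‖∇ω‖² − (ε/4)‖ω‖²` (the Ornstein–Uhlenbeck part is dissipative, with
  spectrum the half-plane `Re λ ≤ −ε/4`), Biot–Savart is bounded `L² → Ḣ¹ ∩ L⁶`, and the Euler
  terms at a decaying background are lower order, so for each `ε > 0` one expects an evolution
  family on `L²_σ(dy)` whose period map has essential spectral radius `e^{−εP/4} < 1`, the
  multiplier `1` being isolated of finite type — the Fredholm frame of crux #3, degenerating exactly
  as `ε → 0` (its "why it might fail"; Friedlander–Vishik at `ε = 0`). Vorticity perturbations of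
  Type-I profiles decay like `|y|⁻²` and lie in `L²(ℝ³)`. Hence the short names use `w = 1`
  (`weightedMeasure 1 = volume`, `divFreeL2 1` = weakly divergence-free `L²(dy)` fields,
  `mem_divFreeL2_one_iff`); every other weight — the Gaussian of the request, or the polynomial
  weights `(1 + |y|²)^{−m}` — is one argument away in the `W` versions, and the planner restating
  stmt-1467 chooses. None of the heuristics of this note is used or asserted by the definitions.
* Multiplicity over `ℝ`: `X_w` is a real Hilbert space and the multiplier in question is `1`; for a
  real eigenvalue the real generalised eigenspace has the complex algebraic multiplicity as its
  dimension, so no complexification is needed. `M` acts on all of `L²(w dy)` and is `0` on `X_wᗮ`,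
  hence `M − 1 = −1` there: the multiplicity of `μ = 1` (indeed of any `μ ≠ 0`) is that of `M|X_w`.
* The evolution family `{S(σ, σ')}` itself is not materialised: Floquet multipliers are the
  eigenvalues of the period map (Kielhöfer 2012, §I.12: "`U(p)` is, by definition, its linear
  period map … The eigenvalues of the period map `U(p)` are called the Floquet multipliers";
  Henry 1981, §7.2), and the period map is all the crux quantifies over.
* `ε ≤ 0` is junk (`ε = 0`: background `0⁻¹ • W₀ = 0`-scaled, period `0`); the route uses
  `ε ∈ (0, ε₁)`. The `ε`-rescaling `U₀(τ, y) = ε⁻¹ • W₀ (τ / ε) y` is spelled exactly as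
  `amplitudeRescale ε W₀ τ y` unfolds.

## References

* H. Kielhöfer, *Bifurcation Theory* (2nd ed., Springer 2012), §I.12, pp. 82–83 (period map,
  Floquet multipliers/exponents, the multiplier `1` of the orbit tangent). [Kielhofer2012]
* D. Henry, *Geometric Theory of Semilinear Parabolic Equations*, LNM 840 (1981), §7.2 (the
  period map of a periodic linear parabolic evolution equation; characteristic multipliers).
  [Henry1981]
* T. Kato, *Perturbation Theory for Linear Operators* (1966), III-§6.5 (algebraic multiplicity of
  an isolated eigenvalue). [Kato1966]
* D. Chae, J. Wolf, Comm. PDE 42 (2017) = arXiv:1610.09464, §4 (backward similarity variables,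
  Leray's system, DSS ⇔ periodicity). [ChaeWolf2017RemovingDSS]
* H. Jia, V. Šverák, JFA 268 (2015) = arXiv:1306.2136, §§1–2 (forward analogue: spectral condition
  for the linearisation at a scale-invariant profile). [JiaSverak2015]
* Th. Gallay, C. E. Wayne, Comm. Math. Phys. 255 (2005), §4.1.3 (Gaussian weighted space for the
  vorticity equation in similarity variables). [GallayWayne2005]
-/

noncomputable section

open MeasureTheory Set Function Filter Topology TopologicalSpace
open scoped NNReal ENNReal InnerProductSpace

namespace Literature.Analysis.FluidPDE

open Literature.Analysis.OperatorTheory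

/-- Local notation for physical space `ℝ³ = EuclideanSpace ℝ (Fin 3)`. -/
local notation "ℝ³" => EuclideanSpace ℝ (Fin 3)

/-! ### The period map of the vorticity equation linearised at a profile -/

/-- **Linearised monodromy at a profile (interface).** For a profile `U : ℝ → ℝ³ → ℝ³` (time
first), a period `P` and a linear isometry `Q`, `M` is a bounded operator on `L²(w dy; ℝ³)` which
(i) maps the solenoidal space `X_w = divFreeL2 w` into itself and vanishes on `X_wᗮ`, and
(ii) **propagates over `[0, P]`, twisted by `Q`**, every weak solution `ω` (accepted class
`IsLinearisedVorticitySolution`) of the vorticity equation of Leray's system linearised at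
`(U, curl U)`, `∂ₛω = (Δ − ½ y·∇ − 1) ω + curl (U × ω) + curl (BS[ω] × curl U)`, whose initial
slice defines an element of `X_w`: `M [ω(0)] = [π̃(Q⁻¹) ω(P)]` (`pseudovectorPush`). This is the
linear period map of the variational equation (Kielhöfer 2012, §I.12; Henry 1981, §7.2) composed
with the symmetry `Q`, the right object for profiles `P`-periodic modulo `Q`,
`U (s + P) (Q y) = Q (U s y)`. Existence/uniqueness of such an `M` is NOT asserted. For
`U = lerayOrbit u`, `P = 2 log c`, `Q = R⁻¹` it is the companion `IsLinearisedMonodromy w c R u M`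
(`isLinearisedMonodromyAt_lerayOrbit_iff`). [cite: Kielhofer2012, §I.12 pp. 82–83 (period map, Floquet multipliers)] -/
structure IsLinearisedMonodromyAt (w : ℝ³ → ℝ≥0) (U : ℝ → ℝ³ → ℝ³) (P : ℝ) (Q : ℝ³ ≃ₗᵢ[ℝ] ℝ³)
    (M : Lp ℝ³ 2 (weightedMeasure w) →L[ℝ] Lp ℝ³ 2 (weightedMeasure w)) : Prop where
  /-- `M` maps the solenoidal space into itself. -/
  mapsTo : ∀ f ∈ divFreeL2 w, M f ∈ divFreeL2 w
  /-- Normalisation: `M` vanishes on the orthogonal complement of the solenoidal space. -/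
  eq_zero : ∀ f ∈ (divFreeL2 w)ᗮ, M f = 0
  /-- `M` reproduces every weak solution of the equation linearised at `(U, curl U)` over `[0, P]`,
  twisted by the pseudovector action of `Q⁻¹`. -/
  propagates : ∀ ω : ℝ → ℝ³ → ℝ³,
    IsLinearisedVorticitySolution U (fun s => curl (U s)) 0 P ω →
      ∀ (h₀ : MemLp (ω 0) 2 (weightedMeasure w))
        (h₁ : MemLp (pseudovectorPush Q.symm (ω P)) 2 (weightedMeasure w)),
        h₀.toLp _ ∈ divFreeL2 w → M (h₀.toLp _) = h₁.toLp _

/-- **Bridge to the companion notion.** At the orbit of a physical field `u`, with period `2 log c`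
and `Q = R⁻¹`, the profile-level interface is VERBATIM `IsLinearisedMonodromy w c R u M` of
`HyperbolicDSSOrbit` (`lerayVorticity u s = curl (lerayOrbit u s)` and `(R⁻¹)⁻¹ = R`,
definitionally). [folklore] -/
theorem isLinearisedMonodromyAt_lerayOrbit_iff (w : ℝ³ → ℝ≥0) (c : ℝ) (R : ℝ³ ≃ₗᵢ[ℝ] ℝ³)
    (u : ℝ → ℝ³ → ℝ³) (M : Lp ℝ³ 2 (weightedMeasure w) →L[ℝ] Lp ℝ³ 2 (weightedMeasure w)) :
    IsLinearisedMonodromyAt w (lerayOrbit u) (2 * Real.log c) R.symm M ↔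
      IsLinearisedMonodromy w c R u M := by
  constructor
  · intro h
    exact ⟨h.mapsTo, h.eq_zero, fun ω hω h₀ h₁ hx => h.propagates ω hω h₀ h₁ hx⟩
  · intro h
    exact ⟨h.mapsTo, h.eq_zero, fun ω hω h₀ h₁ hx => h.propagates ω hω h₀ h₁ hx⟩

namespace IsLinearisedMonodromyAt

variable {w : ℝ³ → ℝ≥0} {U : ℝ → ℝ³ → ℝ³} {P : ℝ} {Q : ℝ³ ≃ₗᵢ[ℝ] ℝ³}
variable {M M₁ M₂ : Lp ℝ³ 2 (weightedMeasure w) →L[ℝ] Lp ℝ³ 2 (weightedMeasure w)}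

/-- Two monodromies agree on the initial class of any weak solution they both propagate. [folklore] -/
theorem apply_eq_of_solution (h₁ : IsLinearisedMonodromyAt w U P Q M₁)
    (h₂ : IsLinearisedMonodromyAt w U P Q M₂) {ω : ℝ → ℝ³ → ℝ³}
    (hω : IsLinearisedVorticitySolution U (fun s => curl (U s)) 0 P ω)
    (h₀ : MemLp (ω 0) 2 (weightedMeasure w))
    (hP : MemLp (pseudovectorPush Q.symm (ω P)) 2 (weightedMeasure w))
    (hx : h₀.toLp _ ∈ divFreeL2 w) : M₁ (h₀.toLp _) = M₂ (h₀.toLp _) := by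
  rw [h₁.propagates ω hω h₀ hP hx, h₂.propagates ω hω h₀ hP hx]

/-- Every element of `L²(w dy)` splits along `X_w ⊕ X_wᗮ` (`X_w` is closed in the complete space
`L²`, hence admits an orthogonal projection). [folklore] -/
theorem exists_add_mem_divFreeL2 (f : Lp ℝ³ 2 (weightedMeasure w)) :
    ∃ x ∈ divFreeL2 w, ∃ p ∈ (divFreeL2 w)ᗮ, f = x + p := by
  haveI : CompleteSpace (divFreeL2 w) := (isClosed_divFreeL2 w).completeSpace_coe
  exact (divFreeL2 w).exists_add_mem_mem_orthogonal f

/-- A monodromy is determined by its values on the solenoidal space. [folklore] -/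
theorem eq_of_eqOn_divFreeL2 (h₁ : IsLinearisedMonodromyAt w U P Q M₁)
    (h₂ : IsLinearisedMonodromyAt w U P Q M₂)
    (h : Set.EqOn M₁ M₂ (divFreeL2 w : Set (Lp ℝ³ 2 (weightedMeasure w)))) : M₁ = M₂ := by
  ext1 f
  obtain ⟨x, hx, p, hp, rfl⟩ := exists_add_mem_divFreeL2 f
  rw [map_add, map_add, h₁.eq_zero p hp, h₂.eq_zero p hp, h hx]

/-- **Uniqueness of the monodromy from density of solvable data.** Let `D ⊆ L²(w dy)` be a set of
classes each of which is the initial class of some weak solution of the linearised equation on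
`[0, P]` (with final twisted slice in `L²(w dy)`) and lies in `X_w`, and suppose the span of `D`
is dense in `X_w`. Then any two linearised monodromies coincide: they agree on `D`
(`apply_eq_of_solution`), hence on its span (linearity) and on the closure (continuity), hence on
`X_w`, and both vanish on `X_wᗮ`. This is the dischargeable form of "the period map is determined
by the dynamics" (Kielhöfer 2012, §I.12: `y(t) = U(t) y₀`). [cite: Kielhofer2012, §I.12 pp. 82–83 (period map, Floquet multipliers)] -/
theorem unique_of_dense (h₁ : IsLinearisedMonodromyAt w U P Q M₁)
    (h₂ : IsLinearisedMonodromyAt w U P Q M₂) {D : Set (Lp ℝ³ 2 (weightedMeasure w))}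
    (hD : ∀ f ∈ D, ∃ (ω : ℝ → ℝ³ → ℝ³) (h₀ : MemLp (ω 0) 2 (weightedMeasure w)),
      IsLinearisedVorticitySolution U (fun s => curl (U s)) 0 P ω ∧
        MemLp (pseudovectorPush Q.symm (ω P)) 2 (weightedMeasure w) ∧
        h₀.toLp _ = f ∧ f ∈ divFreeL2 w)
    (hdense : (divFreeL2 w : Set (Lp ℝ³ 2 (weightedMeasure w))) ⊆
      closure (Submodule.span ℝ D : Set (Lp ℝ³ 2 (weightedMeasure w)))) :
    M₁ = M₂ := by
  -- agreement on `D`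
  have hDeq : Set.EqOn M₁ M₂ D := by
    intro f hf
    obtain ⟨ω, h₀, hω, hP, hf0, hx⟩ := hD f hf
    subst hf0
    exact apply_eq_of_solution h₁ h₂ hω h₀ hP hx
  -- agreement on the span, by linearity
  have hspan : Set.EqOn M₁ M₂ (Submodule.span ℝ D : Set (Lp ℝ³ 2 (weightedMeasure w))) := by
    intro f hf
    induction hf using Submodule.span_induction with
    | mem x hx => exact hDeq hx
    | zero => simp
    | add x y _ _ hx hy => rw [map_add, map_add, hx, hy]
    | smul a x _ hx => rw [map_smul, map_smul, hx]
  -- agreement on the closure, by continuity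
  have hclos : Set.EqOn M₁ M₂ (closure (Submodule.span ℝ D : Set (Lp ℝ³ 2 (weightedMeasure w)))) :=
    hspan.closure M₁.continuous M₂.continuous
  exact eq_of_eqOn_divFreeL2 h₁ h₂ fun f hf => hclos (hdense hf)

/-- The zero operator is a linearised monodromy as soon as every weak solution it must reproduce
has (twisted) final class `0` — in particular vacuously, e.g. on a degenerate period; recorded as
the trivial model of the interface (the junk value of `rescaledEulerLerayMonodromyW`). [folklore] -/
theorem zero_of_forall (h : ∀ ω : ℝ → ℝ³ → ℝ³,
      IsLinearisedVorticitySolution U (fun s => curl (U s)) 0 P ω →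
        ∀ (h₁ : MemLp (pseudovectorPush Q.symm (ω P)) 2 (weightedMeasure w)), h₁.toLp _ = 0) :
    IsLinearisedMonodromyAt w U P Q 0 where
  mapsTo _ _ := by simp
  eq_zero _ _ := rfl
  propagates ω hω h₀ h₁ _ := by rw [h ω hω h₁]; rfl

end IsLinearisedMonodromyAt

/-! ### The `ε`-monodromy of the rescaled Euler–Leray system and its Floquet multiplicities -/

section Rescaled

variable (w : ℝ³ → ℝ≥0) (ε : ℝ) (W₀ : ℝ → ℝ³ → ℝ³) (P : ℝ) (Q : ℝ³ ≃ₗᵢ[ℝ] ℝ³)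

/-- **The period-`P` monodromy of the rescaled Euler–Leray system linearised at `W₀`, composed
with `Q`, in `X_w` (interface).** The linearisation
`L_ε v = ∂_σ v + P[W₀·∇v + v·∇W₀] − ε(Δv − ½(v + y·∇v))` of
`∂_σW + W·∇W + ∇Π = ε(ΔW − ½(W + y·∇W))` at `W₀` over `[0, P]` is, after the amplitude–time
rescaling `U₀(τ) = ε⁻¹ W₀(τ/ε)` (`amplitudeRescale ε W₀`, which maps the parameter-`ε` system to
Leray's system, `ε = 1`) and `τ = εσ`, the Leray linearisation at `U₀` over `[0, εP]`; in
vorticity form (`∂ₜω = ε(Δ − ½y·∇ − 1)ω + curl(W₀ × ω) + curl(BS[ω] × curl W₀)` ↔ the `ε = 1`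
equation for `ω̃(τ) = ω(τ/ε)`) the period maps coincide. So: `M` is such a monodromy iff it is a
linearised monodromy at the profile `amplitudeRescale ε W₀` with period `εP` twisted by `Q`
(`IsLinearisedMonodromyAt`). Meaningful for `0 < ε`; `ε = 1` is the profile-level notion itself
(`isRescaledEulerLerayMonodromyW_one_iff`). Route `EulerMelnikovDss`, crux
`FiniteMelnikovCokernel`. [cite: Kielhofer2012, §I.12 pp. 82–83 (period map, Floquet multipliers)] -/
def IsRescaledEulerLerayMonodromyW
    (M : Lp ℝ³ 2 (weightedMeasure w) →L[ℝ] Lp ℝ³ 2 (weightedMeasure w)) : Prop :=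
  IsLinearisedMonodromyAt w (fun τ y => ε⁻¹ • W₀ (τ / ε) y) (ε * P) Q M

/-- **THE `ε`-monodromy** of the rescaled Euler–Leray system at `W₀` (period `P`, twist `Q`) in
`X_w`, as an operator on `L²(w dy; ℝ³)`: the unique `M` with `IsRescaledEulerLerayMonodromyW w ε W₀
P Q M` when such an `M` exists and is unique (Kielhöfer 2012, §I.12: the linear period map
`U(p)`), and the **junk value `0`** otherwise (flagged by `floquetMultiplicityW = ⊤`). [cite: Kielhofer2012, §I.12 pp. 82–83 (period map, Floquet multipliers)] -/
def rescaledEulerLerayMonodromyW :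
    Lp ℝ³ 2 (weightedMeasure w) →L[ℝ] Lp ℝ³ 2 (weightedMeasure w) := by
  classical
  exact if h : ∃! M, IsRescaledEulerLerayMonodromyW w ε W₀ P Q M then h.choose else 0

/-- **The algebraic multiplicity of the real Floquet multiplier `μ`** of the `ε`-monodromy at `W₀`
(period `P`, twist `Q`) in `X_w`: Kato's algebraic multiplicity
(`Literature.Analysis.OperatorTheory.algebraicMultiplicity`: the dimension of the generalised
eigenspace `⋃ₖ ker (M − μ)ᵏ` when `μ` is a regular point or an isolated eigenvalue of finite type,
`⊤` otherwise — in particular when `μ` is in the essential spectrum) of the monodromy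
`rescaledEulerLerayMonodromyW w ε W₀ P Q`, and `⊤` when NO unique monodromy exists (Kielhöfer
2012, §I.12: Floquet multipliers = eigenvalues of the period map, counted with algebraic
multiplicity). A finite value therefore certifies: the period map exists, is unique, and `μ` is a
normal point of it. [cite: Kielhofer2012, §I.12 pp. 82–83 (period map, Floquet multipliers)] -/
def floquetMultiplicityW (μ : ℝ) : ℕ∞ := by
  classical
  exact if ∃! M, IsRescaledEulerLerayMonodromyW w ε W₀ P Q M then
    algebraicMultiplicity (rescaledEulerLerayMonodromyW w ε W₀ P Q) μ else ⊤

variable {w ε W₀ P Q}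

/-- `ε = 1`: the `ε`-monodromy interface is the profile-level interface at `W₀` itself
(`1⁻¹ • W₀ (τ/1) = W₀ τ`, `1 · P = P`). [folklore] -/
theorem isRescaledEulerLerayMonodromyW_one_iff
    (M : Lp ℝ³ 2 (weightedMeasure w) →L[ℝ] Lp ℝ³ 2 (weightedMeasure w)) :
    IsRescaledEulerLerayMonodromyW w 1 W₀ P Q M ↔ IsLinearisedMonodromyAt w W₀ P Q M := by
  have h1 : (fun τ (y : ℝ³) => (1 : ℝ)⁻¹ • W₀ (τ / 1) y) = W₀ := by
    funext τ y; simp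
  rw [IsRescaledEulerLerayMonodromyW, h1, one_mul]

/-- In particular, at the orbit of a physical field with the DSS period and isometry, the
`ε = 1` monodromy interface is the companion's `IsLinearisedMonodromy` (the two requested notions
are the same operator family). [folklore] -/
theorem isRescaledEulerLerayMonodromyW_one_lerayOrbit_iff (c : ℝ) (R : ℝ³ ≃ₗᵢ[ℝ] ℝ³)
    (u : ℝ → ℝ³ → ℝ³) (M : Lp ℝ³ 2 (weightedMeasure w) →L[ℝ] Lp ℝ³ 2 (weightedMeasure w)) :
    IsRescaledEulerLerayMonodromyW w 1 (lerayOrbit u) (2 * Real.log c) R.symm M ↔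
      IsLinearisedMonodromy w c R u M := by
  rw [isRescaledEulerLerayMonodromyW_one_iff, isLinearisedMonodromyAt_lerayOrbit_iff]

/-- When a unique monodromy exists, `rescaledEulerLerayMonodromyW` is a monodromy. [folklore] -/
theorem isRescaledEulerLerayMonodromyW_rescaledEulerLerayMonodromyW
    (h : ∃! M, IsRescaledEulerLerayMonodromyW w ε W₀ P Q M) :
    IsRescaledEulerLerayMonodromyW w ε W₀ P Q (rescaledEulerLerayMonodromyW w ε W₀ P Q) := by
  classical
  rw [rescaledEulerLerayMonodromyW, dif_pos h]
  exact h.choose_spec.1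

/-- When a unique monodromy exists, `rescaledEulerLerayMonodromyW` IS it. [folklore] -/
theorem IsRescaledEulerLerayMonodromyW.rescaledEulerLerayMonodromyW_eq
    {M : Lp ℝ³ 2 (weightedMeasure w) →L[ℝ] Lp ℝ³ 2 (weightedMeasure w)}
    (h : ∃! M, IsRescaledEulerLerayMonodromyW w ε W₀ P Q M)
    (hM : IsRescaledEulerLerayMonodromyW w ε W₀ P Q M) :
    rescaledEulerLerayMonodromyW w ε W₀ P Q = M :=
  h.unique (isRescaledEulerLerayMonodromyW_rescaledEulerLerayMonodromyW h) hM

/-- Without a unique monodromy the operator is the junk value `0`. [folklore] -/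
theorem rescaledEulerLerayMonodromyW_of_not_existsUnique
    (h : ¬ ∃! M, IsRescaledEulerLerayMonodromyW w ε W₀ P Q M) :
    rescaledEulerLerayMonodromyW w ε W₀ P Q = 0 := by
  classical
  rw [rescaledEulerLerayMonodromyW, dif_neg h]

/-- **Unfolding the Floquet multiplicity**: for the unique monodromy `M`,
`floquetMultiplicityW w ε W₀ P Q μ = algebraicMultiplicity M μ`. [folklore] -/
theorem IsRescaledEulerLerayMonodromyW.floquetMultiplicityW_eq
    {M : Lp ℝ³ 2 (weightedMeasure w) →L[ℝ] Lp ℝ³ 2 (weightedMeasure w)}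
    (h : ∃! M, IsRescaledEulerLerayMonodromyW w ε W₀ P Q M)
    (hM : IsRescaledEulerLerayMonodromyW w ε W₀ P Q M) (μ : ℝ) :
    floquetMultiplicityW w ε W₀ P Q μ = algebraicMultiplicity M μ := by
  classical
  rw [floquetMultiplicityW, if_pos h, hM.rescaledEulerLerayMonodromyW_eq h]

/-- Without a unique monodromy every Floquet multiplicity is `⊤`. [folklore] -/
theorem floquetMultiplicityW_eq_top (h : ¬ ∃! M, IsRescaledEulerLerayMonodromyW w ε W₀ P Q M)
    (μ : ℝ) : floquetMultiplicityW w ε W₀ P Q μ = ⊤ := by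
  classical
  rw [floquetMultiplicityW, if_neg h]

/-- **What a finite Floquet multiplicity certifies**: `floquetMultiplicityW … μ ≠ ⊤` iff a unique
monodromy exists AND `μ` has finite algebraic multiplicity for it (regular point or isolated
eigenvalue of finite type, Kato III-§6.5). [cite: Kato1966, III-§6.5] -/
theorem floquetMultiplicityW_ne_top_iff (μ : ℝ) :
    floquetMultiplicityW w ε W₀ P Q μ ≠ ⊤ ↔
      (∃! M, IsRescaledEulerLerayMonodromyW w ε W₀ P Q M) ∧
        HasFiniteAlgebraicMultiplicity (rescaledEulerLerayMonodromyW w ε W₀ P Q) μ := by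
  classical
  unfold floquetMultiplicityW
  split_ifs with h
  · rw [algebraicMultiplicity_ne_top_iff]
    exact ⟨fun hf => ⟨h, hf⟩, fun hf => hf.2⟩
  · simp only [ne_eq, not_true_eq_false, h, false_and]

/-- A finite Floquet multiplicity is the dimension of the generalised eigenspace of the (unique)
monodromy. [cite: Kato1966, III-§6.5] -/
theorem floquetMultiplicityW_eq_finrank_of_ne_top {μ : ℝ}
    (h : floquetMultiplicityW w ε W₀ P Q μ ≠ ⊤) :
    floquetMultiplicityW w ε W₀ P Q μ =
      Module.finrank ℝ (Module.End.maxGenEigenspace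
        (rescaledEulerLerayMonodromyW w ε W₀ P Q :
          Module.End ℝ (Lp ℝ³ 2 (weightedMeasure w))) μ) := by
  classical
  obtain ⟨hu, hf⟩ := (floquetMultiplicityW_ne_top_iff μ).1 h
  rw [floquetMultiplicityW, if_pos hu, algebraicMultiplicity_of_hasFiniteAlgebraicMultiplicity hf]

end Rescaled

/-! ### The requested short names: the solenoidal vorticity space `L²_σ(ℝ³, dy)` (`w = 1`) -/

/-- The flat weight gives Lebesgue measure: `weightedMeasure 1 = volume`. [folklore] -/
theorem weightedMeasure_one : weightedMeasure (1 : ℝ³ → ℝ≥0) = volume := by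
  unfold weightedMeasure
  simp only [Pi.one_apply, ENNReal.coe_one]
  exact withDensity_one

/-- For the flat weight, `divFreeL2 1` is the space of weakly divergence-free `L²(ℝ³, dy; ℝ³)`
fields (accepted `IsWeaklyDivFree`). [folklore] -/
theorem mem_divFreeL2_one_iff (f : Lp ℝ³ 2 (weightedMeasure (1 : ℝ³ → ℝ≥0))) :
    f ∈ divFreeL2 (1 : ℝ³ → ℝ≥0) ↔ IsWeaklyDivFree (f : ℝ³ → ℝ³) :=
  mem_divFreeL2_iff_isWeaklyDivFree continuous_const (fun _ => one_pos) f

section Flat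

variable (ε : ℝ) (W₀ : ℝ → ℝ³ → ℝ³) (P : ℝ) (Q : ℝ³ ≃ₗᵢ[ℝ] ℝ³)

/-- The `ε`-monodromy interface in the solenoidal vorticity space `X = L²_σ(ℝ³, dy)` (flat
weight `w = 1`; see the module docstring, design note "choice of the space", for why this and not
the Gaussian weight is the default, and `IsRescaledEulerLerayMonodromyW` for any other weight). [folklore] -/
abbrev IsRescaledEulerLerayMonodromy
    (M : Lp ℝ³ 2 (weightedMeasure (1 : ℝ³ → ℝ≥0)) →L[ℝ]
      Lp ℝ³ 2 (weightedMeasure (1 : ℝ³ → ℝ≥0))) : Prop :=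
  IsRescaledEulerLerayMonodromyW 1 ε W₀ P Q M

/-- **`rescaledEulerLerayMonodromy ε W₀ P Q`** — the period-`P` monodromy of the rescaled
Euler–Leray system linearised at `W₀`, composed with the action of `Q`, on the solenoidal
vorticity space `L²_σ(ℝ³, dy)` (unique choice; junk `0` when no unique monodromy exists, flagged
by `floquetMultiplicityOne = ⊤`). [cite: Kielhofer2012, §I.12 pp. 82–83 (period map, Floquet multipliers)] -/
abbrev rescaledEulerLerayMonodromy :
    Lp ℝ³ 2 (weightedMeasure (1 : ℝ³ → ℝ≥0)) →L[ℝ] Lp ℝ³ 2 (weightedMeasure (1 : ℝ³ → ℝ≥0)) :=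
  rescaledEulerLerayMonodromyW 1 ε W₀ P Q

/-- The algebraic multiplicity of the real Floquet multiplier `μ` of `rescaledEulerLerayMonodromy`
(`⊤` without a unique monodromy or when `μ` is not a normal point). [cite: Kielhofer2012, §I.12 pp. 82–83 (period map, Floquet multipliers)] -/
abbrev floquetMultiplicity (μ : ℝ) : ℕ∞ :=
  floquetMultiplicityW 1 ε W₀ P Q μ

/-- **`floquetMultiplicityOne ε W₀ P Q`** — the algebraic multiplicity of the Floquet multiplier
`1` of the `ε`-monodromy at `W₀` (period `P`, twist `Q`) in `L²_σ(ℝ³, dy)`; `⊤` if no unique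
monodromy exists, if `1` is in the essential spectrum, or if the generalised eigenspace is
infinite-dimensional. With it crux `FiniteMelnikovCokernel` of route `EulerMelnikovDss` reads
`∃ ε₁ > 0, ∃ m : ℕ, ∀ ε ∈ Set.Ioo 0 ε₁, floquetMultiplicityOne ε W₀ P Q = m` (Kielhöfer 2012,
§I.12: `1` is always a multiplier, with eigenfunction the orbit tangent; the crux counts the
further neutral directions). [cite: Kielhofer2012, §I.12 pp. 82–83 (period map, Floquet multipliers)] -/
abbrev floquetMultiplicityOne : ℕ∞ :=
  floquetMultiplicity ε W₀ P Q 1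

/-- Unfolding the short names (definitional). [folklore] -/
theorem floquetMultiplicityOne_eq :
    floquetMultiplicityOne ε W₀ P Q = floquetMultiplicityW 1 ε W₀ P Q 1 :=
  rfl

variable {ε W₀ P Q}

/-- The requested multiplicity, evaluated: for the unique monodromy `M`,
`floquetMultiplicityOne ε W₀ P Q = algebraicMultiplicity M 1`. [folklore] -/
theorem IsRescaledEulerLerayMonodromy.floquetMultiplicityOne_eq
    {M : Lp ℝ³ 2 (weightedMeasure (1 : ℝ³ → ℝ≥0)) →L[ℝ]
      Lp ℝ³ 2 (weightedMeasure (1 : ℝ³ → ℝ≥0))}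
    (h : ∃! M, IsRescaledEulerLerayMonodromy ε W₀ P Q M)
    (hM : IsRescaledEulerLerayMonodromy ε W₀ P Q M) :
    floquetMultiplicityOne ε W₀ P Q = algebraicMultiplicity M 1 :=
  IsRescaledEulerLerayMonodromyW.floquetMultiplicityW_eq h hM 1

/-- A finite `floquetMultiplicityOne` certifies a unique monodromy for which `1` is a normal
point. [cite: Kato1966, III-§6.5] -/
theorem floquetMultiplicityOne_ne_top_iff :
    floquetMultiplicityOne ε W₀ P Q ≠ ⊤ ↔
      (∃! M, IsRescaledEulerLerayMonodromy ε W₀ P Q M) ∧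
        HasFiniteAlgebraicMultiplicity (rescaledEulerLerayMonodromy ε W₀ P Q) 1 :=
  floquetMultiplicityW_ne_top_iff 1

end Flat

end Literature.Analysis.FluidPDE
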